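import Summits.KontsevichZagierPeriods.KontsevichZagierPeriods.Theorems.FermatIsogenyBetaProductSectorStubTwinDupStepLeft
import Summits.KontsevichZagierPeriods.KontsevichZagierPeriods.Theorems.FermatIsogenyBetaProductSectorStubTwinDupStepLaps
import Summits.KontsevichZagierPeriods.KontsevichZagierPeriods.Theorems.FermatIsogenyBetaProductSectorStubDdStep

/-!
# `BetaProductSector` (stmt-KontsevichZagierPeriods-3898), line `registered` (v3) — stub `stub_twinDupStep`,
# part 5: integrands, pull-back identities and the right box chain of the twin-duplication move X9

Fifth part of the twin-duplication move X9 `B(a+b-½, b+½)·B(b, a+½-b) = 4^{a-b}·B(a+b-½, a+½-b)·B(a, 2b)`.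
Part 4 carried the unweighted left box onto the parameter triangle `Ω = {(t,m) | 0 < t < m < 1}` with the left
integrand `ℓ = 2·pre·2m(m²-t²)`, `pre = (4mt)^{a-1}(4t(m-t)(1-m²))^{2b-1}(64t)^{½-b}D̂^{-a-2b}`,
`D̂ = m(m-t)² + t(1+m)²`. This file supplies

* the (by `4^{a-b}` weighted) RIGHT box `R = [(0,1)², 2x^{a+b-3/2}(4(1-x))^{a-b-½}y^{a-1}(1-y)^{2b-1}]`, which exists
  (Euler's Beta integral), and its transport onto `Ω` along the rational charts `ρ(x,m) = (x, m/D̃)` and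
  `κ(x,m) = (m²(1-x)/x, m)` of part 1 (`TwinDupStep.right_box_chain`): `[Ω, 2·pre·t(1+m²-2mt)] ∼ R`;
* the unfolded Euler–Mellin integrands of the branch exchange of part 6 — the split `ℓ = r + G` with the
  SIGN-CHANGING ghost term `G = 2·pre·c`, `c = 2m³ - tm² - t` (`-4tc/D̂² = ∂P/∂m`, `P = 4mt/D̂`), and the ghost
  integrand `P^{a-1}(P(1+t)²-4t)^{2b-1}(64t)^{½-b}(2t)^{-1}` of the image `E` of the ghost chart `(t,m) ↦ (t,P)` —
  with their pull-back identities (`Real.rpow` bookkeeping by logarithms).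

Everything is proved; no `def`, no named fact.
-/

noncomputable section

open MeasureTheory Set
open Literature.ModelTheory.ExponentialFields (IsSemialgebraic)
open MvPolynomial (aeval X C)

namespace Summit.KontsevichZagierPeriods.FermatIsogeny.BetaProductSectorStubs

open Literature.NumberTheory.Transcendental
open Literature.NumberTheory.Transcendental.KZ

namespace TwinDupStep

/-! ## The Euler–Mellin integrands of the right chain, unfolded -/

/-- The right integrand `r = 2·pre·t(1+m²-2mt)` of the parameter triangle, unfolded. [folklore] -/
theorem mellin_r_apply (a b : ℚ) (z : Fin 2 → ℝ) :
    KZ.mellinIntegrand (![4 * X 1 * X 0, 4 * X 0 * (X 1 - X 0) * (1 - X 1 ^ 2), 64 * X 0,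
        X 1 * (X 1 - X 0) ^ 2 + X 0 * (1 + X 1) ^ 2, X 0 * (1 + X 1 ^ 2 - 2 * X 1 * X 0)] :
          Fin 5 → MvPolynomial (Fin 2) ℚ) ![a - 1, 2 * b - 1, 1 / 2 - b, -a - 2 * b, 1] 2 z =
      2 * ((4 * z 1 * z 0) ^ ((a:ℝ) - 1) * (4 * z 0 * (z 1 - z 0) * (1 - z 1 ^ 2)) ^ (2 * (b:ℝ) - 1) *
        (64 * z 0) ^ (1 / 2 - (b:ℝ)) * (z 1 * (z 1 - z 0) ^ 2 + z 0 * (1 + z 1) ^ 2) ^ (-(a:ℝ) - 2 * b) *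
        (z 0 * (1 + z 1 ^ 2 - 2 * z 1 * z 0))) := by
  rw [mellin_omega_apply]
  simp only [map_sub, map_mul, map_add, map_pow, map_one, map_ofNat, MvPolynomial.aeval_X]

/-- The ghost term `G = 2·pre·c` on the lap `Ω₊`, unfolded. [folklore] -/
theorem mellin_Gp_apply (a b : ℚ) (z : Fin 2 → ℝ) :
    KZ.mellinIntegrand (![4 * X 1 * X 0, 4 * X 0 * (X 1 - X 0) * (1 - X 1 ^ 2), 64 * X 0,
        X 1 * (X 1 - X 0) ^ 2 + X 0 * (1 + X 1) ^ 2, 2 * X 1 ^ 3 - X 0 * X 1 ^ 2 - X 0] :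
          Fin 5 → MvPolynomial (Fin 2) ℚ) ![a - 1, 2 * b - 1, 1 / 2 - b, -a - 2 * b, 1] 2 z =
      2 * ((4 * z 1 * z 0) ^ ((a:ℝ) - 1) * (4 * z 0 * (z 1 - z 0) * (1 - z 1 ^ 2)) ^ (2 * (b:ℝ) - 1) *
        (64 * z 0) ^ (1 / 2 - (b:ℝ)) * (z 1 * (z 1 - z 0) ^ 2 + z 0 * (1 + z 1) ^ 2) ^ (-(a:ℝ) - 2 * b) *
        (2 * z 1 ^ 3 - z 0 * z 1 ^ 2 - z 0)) := by
  rw [mellin_omega_apply]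
  simp only [map_sub, map_mul, map_pow, map_ofNat, MvPolynomial.aeval_X]

/-- The opposite ghost term `-G = 2·pre·(-c)` on the lap `Ω₋`, unfolded. [folklore] -/
theorem mellin_Gn_apply (a b : ℚ) (z : Fin 2 → ℝ) :
    KZ.mellinIntegrand (![4 * X 1 * X 0, 4 * X 0 * (X 1 - X 0) * (1 - X 1 ^ 2), 64 * X 0,
        X 1 * (X 1 - X 0) ^ 2 + X 0 * (1 + X 1) ^ 2, -(2 * X 1 ^ 3 - X 0 * X 1 ^ 2 - X 0)] :
          Fin 5 → MvPolynomial (Fin 2) ℚ) ![a - 1, 2 * b - 1, 1 / 2 - b, -a - 2 * b, 1] 2 z =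
      2 * ((4 * z 1 * z 0) ^ ((a:ℝ) - 1) * (4 * z 0 * (z 1 - z 0) * (1 - z 1 ^ 2)) ^ (2 * (b:ℝ) - 1) *
        (64 * z 0) ^ (1 / 2 - (b:ℝ)) * (z 1 * (z 1 - z 0) ^ 2 + z 0 * (1 + z 1) ^ 2) ^ (-(a:ℝ) - 2 * b) *
        (-(2 * z 1 ^ 3 - z 0 * z 1 ^ 2 - z 0))) := by
  rw [mellin_omega_apply]
  simp only [map_neg, map_sub, map_mul, map_pow, map_ofNat, MvPolynomial.aeval_X]

/-- The ghost integrand `P^{a-1}(P(1+t)²-4t)^{2b-1}(64t)^{½-b}(2t)^{-1}` of the image `E` (coordinates `(t,P)`),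
unfolded. [folklore] -/
theorem mellin_E_apply (a b : ℚ) (y : Fin 2 → ℝ) :
    KZ.mellinIntegrand (![X 1, X 1 * (1 + X 0) ^ 2 - 4 * X 0, 64 * X 0, 2 * X 0] : Fin 4 → MvPolynomial (Fin 2) ℚ)
        ![a - 1, 2 * b - 1, 1 / 2 - b, -1] 1 y =
      1 * ((y 1) ^ ((a:ℝ) - 1) * (y 1 * (1 + y 0) ^ 2 - 4 * y 0) ^ (2 * (b:ℝ) - 1) *
        (64 * y 0) ^ (1 / 2 - (b:ℝ)) * (2 * y 0) ^ (-1:ℝ)) := by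
  rw [KZ.mellinIntegrand_apply, Fin.prod_univ_four]
  simp only [Matrix.cons_val_zero, Matrix.cons_val_one, Matrix.cons_val, map_sub, map_mul, map_add, map_pow,
    map_one, map_ofNat, MvPolynomial.aeval_X]
  push_cast
  ring_nf

/-- The transported right integrand `r'` of the region `Ω'` (coordinates `(x,m)`), unfolded. [folklore] -/
theorem mellin_rprime_apply (a b : ℚ) (z : Fin 2 → ℝ) :
    KZ.mellinIntegrand (![X 0, 4 * (1 - X 0), X 1, (1 - X 0) * (X 0 - X 1 * (1 - X 0)) * (1 - X 1 ^ 2),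
        X 1 * (X 0 - X 1 * (1 - X 0)) ^ 2 + X 0 * (1 - X 0) * (1 + X 1) ^ 2,
        X 0 + X 1 ^ 2 * X 0 - 2 * X 1 ^ 3 * (1 - X 0)] : Fin 6 → MvPolynomial (Fin 2) ℚ)
        ![a + b - 3 / 2, a - b + 1 / 2, a - 1, 2 * b - 1, -a - 2 * b, 1] (1 / 2) z =
      1 / 2 * ((z 0) ^ ((a:ℝ) + b - 3 / 2) * (4 * (1 - z 0)) ^ ((a:ℝ) - b + 1 / 2) * (z 1) ^ ((a:ℝ) - 1) *
        ((1 - z 0) * (z 0 - z 1 * (1 - z 0)) * (1 - z 1 ^ 2)) ^ (2 * (b:ℝ) - 1) *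
        (z 1 * (z 0 - z 1 * (1 - z 0)) ^ 2 + z 0 * (1 - z 0) * (1 + z 1) ^ 2) ^ (-(a:ℝ) - 2 * b) *
        (z 0 + z 1 ^ 2 * z 0 - 2 * z 1 ^ 3 * (1 - z 0))) := by
  rw [KZ.mellinIntegrand_apply, Fin.prod_univ_six]
  simp only [Matrix.cons_val_zero, Matrix.cons_val_one, Matrix.cons_val, map_sub, map_mul, map_add, map_pow,
    map_one, map_ofNat, MvPolynomial.aeval_X]
  push_cast
  rw [Real.rpow_one]

/-- The weighted right box integrand `2 x^{a+b-3/2} (4(1-x))^{a-b-½} y^{a-1} (1-y)^{2b-1}`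
(`= 4^{a-b} x^{a+b-3/2}(1-x)^{a-b-½} y^{a-1}(1-y)^{2b-1}`), unfolded. [folklore] -/
theorem mellin_Rw_apply (a b : ℚ) (z : Fin 2 → ℝ) :
    KZ.mellinIntegrand (![X 0, 4 * (1 - X 0), X 1, 1 - X 1] : Fin 4 → MvPolynomial (Fin 2) ℚ)
        ![a + b - 3 / 2, a - b - 1 / 2, a - 1, 2 * b - 1] 2 z =
      2 * ((z 0) ^ ((a:ℝ) + b - 3 / 2) * (4 * (1 - z 0)) ^ ((a:ℝ) - b - 1 / 2) * (z 1) ^ ((a:ℝ) - 1) *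
        (1 - z 1) ^ (2 * (b:ℝ) - 1)) := by
  rw [KZ.mellinIntegrand_apply, Fin.prod_univ_four]
  simp only [Matrix.cons_val_zero, Matrix.cons_val_one, Matrix.cons_val, map_sub, map_mul, map_one, map_ofNat,
    MvPolynomial.aeval_X]
  push_cast
  ring_nf

/-! ## Pointwise identities of the right chain -/

/-- **The split `ℓ = r + G`** of the left integrand (`2m(m²-t²) = t(1+m²-2mt) + c`). [folklore] -/
theorem ell_eq_r_add_Gp (a b : ℚ) (z : Fin 2 → ℝ) :
    KZ.mellinIntegrand (![4 * X 1 * X 0, 4 * X 0 * (X 1 - X 0) * (1 - X 1 ^ 2), 64 * X 0,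
        X 1 * (X 1 - X 0) ^ 2 + X 0 * (1 + X 1) ^ 2, 2 * X 1 * (X 1 ^ 2 - X 0 ^ 2)] :
          Fin 5 → MvPolynomial (Fin 2) ℚ) ![a - 1, 2 * b - 1, 1 / 2 - b, -a - 2 * b, 1] 2 z =
      KZ.mellinIntegrand (![4 * X 1 * X 0, 4 * X 0 * (X 1 - X 0) * (1 - X 1 ^ 2), 64 * X 0,
        X 1 * (X 1 - X 0) ^ 2 + X 0 * (1 + X 1) ^ 2, X 0 * (1 + X 1 ^ 2 - 2 * X 1 * X 0)] :
          Fin 5 → MvPolynomial (Fin 2) ℚ) ![a - 1, 2 * b - 1, 1 / 2 - b, -a - 2 * b, 1] 2 z +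
      KZ.mellinIntegrand (![4 * X 1 * X 0, 4 * X 0 * (X 1 - X 0) * (1 - X 1 ^ 2), 64 * X 0,
        X 1 * (X 1 - X 0) ^ 2 + X 0 * (1 + X 1) ^ 2, 2 * X 1 ^ 3 - X 0 * X 1 ^ 2 - X 0] :
          Fin 5 → MvPolynomial (Fin 2) ℚ) ![a - 1, 2 * b - 1, 1 / 2 - b, -a - 2 * b, 1] 2 z := by
  rw [mellin_ell_apply, mellin_r_apply, mellin_Gp_apply]
  ring

/-- **The split `r = ℓ + (-G)`** on the other lap. [folklore] -/
theorem r_eq_ell_add_Gn (a b : ℚ) (z : Fin 2 → ℝ) :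
    KZ.mellinIntegrand (![4 * X 1 * X 0, 4 * X 0 * (X 1 - X 0) * (1 - X 1 ^ 2), 64 * X 0,
        X 1 * (X 1 - X 0) ^ 2 + X 0 * (1 + X 1) ^ 2, X 0 * (1 + X 1 ^ 2 - 2 * X 1 * X 0)] :
          Fin 5 → MvPolynomial (Fin 2) ℚ) ![a - 1, 2 * b - 1, 1 / 2 - b, -a - 2 * b, 1] 2 z =
      KZ.mellinIntegrand (![4 * X 1 * X 0, 4 * X 0 * (X 1 - X 0) * (1 - X 1 ^ 2), 64 * X 0,
        X 1 * (X 1 - X 0) ^ 2 + X 0 * (1 + X 1) ^ 2, 2 * X 1 * (X 1 ^ 2 - X 0 ^ 2)] :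
          Fin 5 → MvPolynomial (Fin 2) ℚ) ![a - 1, 2 * b - 1, 1 / 2 - b, -a - 2 * b, 1] 2 z +
      KZ.mellinIntegrand (![4 * X 1 * X 0, 4 * X 0 * (X 1 - X 0) * (1 - X 1 ^ 2), 64 * X 0,
        X 1 * (X 1 - X 0) ^ 2 + X 0 * (1 + X 1) ^ 2, -(2 * X 1 ^ 3 - X 0 * X 1 ^ 2 - X 0)] :
          Fin 5 → MvPolynomial (Fin 2) ℚ) ![a - 1, 2 * b - 1, 1 / 2 - b, -a - 2 * b, 1] 2 z := by
  rw [mellin_ell_apply, mellin_r_apply, mellin_Gn_apply]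
  ring

/-- Pull-back of the weighted right box integrand along the chart `ρ(x,m) = (x, m/D̃)`, times the Jacobian
`(1-x)(x+m²x-2m³(1-x))/D̃²`: the transported right integrand `r'` of `Ω'`. [folklore] -/
theorem rho_pullback : ∀ (a b : ℝ) {x m : ℝ}, 0 < x → x < 1 → 0 < m → m < 1 → m * (1 - x) < x → 2 * (x ^ (a + b - 3 / 2) * (4 * (1 - x)) ^ (a - b - 1 / 2) * (m / (m * (x - m * (1 - x)) ^ 2 + x * (1 - x) * (1 + m) ^ 2)) ^ (a - 1) * (1 - m / (m * (x - m * (1 - x)) ^ 2 + x * (1 - x) * (1 + m) ^ 2)) ^ (2 * b - 1)) * ((1 - x) * (x + m ^ 2 * x - 2 * m ^ 3 * (1 - x)) / (m * (x - m * (1 - x)) ^ 2 + x * (1 - x) * (1 + m) ^ 2) ^ 2) = 1 / 2 * (x ^ (a + b - 3 / 2) * (4 * (1 - x)) ^ (a - b + 1 / 2) * m ^ (a - 1) * ((1 - x) * (x - m * (1 - x)) * (1 - m ^ 2)) ^ (2 * b - 1) * (m * (x - m * (1 - x)) ^ 2 + x * (1 - x) * (1 + m) ^ 2) ^ (-a -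 2 * b) * (x + m ^ 2 * x - 2 * m ^ 3 * (1 - x))) := by
  intro a b x m hx hx1 hm hm1 hc
  have h1x : 0 < 1 - x := by linarith
  have hu : 0 < x - m * (1 - x) := by linarith
  have h1m : 0 < 1 + m := by linarith
  have h1m' : 0 < 1 - m := by linarith
  have hD : 0 < m * (x - m * (1 - x)) ^ 2 + x * (1 - x) * (1 + m) ^ 2 := by positivity
  have hJ : 0 < x + m ^ 2 * x - 2 * m ^ 3 * (1 - x) := by
    have h1 : 2 * m ^ 3 * (1 - x) < 2 * m ^ 2 * x := by nlinarith [pow_pos hm 2]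
    have h2 : 0 < x * (1 - m ^ 2) := mul_pos hx (by nlinarith)
    nlinarith
  have e1 : 1 - m / (m * (x - m * (1 - x)) ^ 2 + x * (1 - x) * (1 + m) ^ 2) =
      (1 - x) * (x - m * (1 - x)) * ((1 - m) * (1 + m)) / (m * (x - m * (1 - x)) ^ 2 + x * (1 - x) * (1 + m) ^ 2) := by
    field_simp
    ring
  have e3 : (1:ℝ) - m ^ 2 = (1 - m) * (1 + m) := by ring
  have e4' : (4:ℝ) = 2 ^ 2 := by norm_num
  rw [e1, e3, e4']
  have hl : 0 < 2 * (x ^ (a + b - 3 / 2) * ((2:ℝ) ^ 2 * (1 - x)) ^ (a - b - 1 / 2) *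
        (m / (m * (x - m * (1 - x)) ^ 2 + x * (1 - x) * (1 + m) ^ 2)) ^ (a - 1) *
        ((1 - x) * (x - m * (1 - x)) * ((1 - m) * (1 + m)) /
          (m * (x - m * (1 - x)) ^ 2 + x * (1 - x) * (1 + m) ^ 2)) ^ (2 * b - 1)) *
      ((1 - x) * (x + m ^ 2 * x - 2 * m ^ 3 * (1 - x)) /
        (m * (x - m * (1 - x)) ^ 2 + x * (1 - x) * (1 + m) ^ 2) ^ 2) := by
    positivity
  have hr : 0 < 1 / 2 * (x ^ (a + b - 3 / 2) * ((2:ℝ) ^ 2 * (1 - x)) ^ (a - b + 1 / 2) * m ^ (a - 1) *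
      ((1 - x) * (x - m * (1 - x)) * ((1 - m) * (1 + m))) ^ (2 * b - 1) *
      (m * (x - m * (1 - x)) ^ 2 + x * (1 - x) * (1 + m) ^ 2) ^ (-a - 2 * b) *
      (x + m ^ 2 * x - 2 * m ^ 3 * (1 - x))) := by
    positivity
  rw [← Real.exp_log hl, ← Real.exp_log hr]
  congr 1
  simp (disch := positivity) only [Real.log_mul, Real.log_rpow, Real.log_div, Real.log_pow, Real.log_one]
  ring

/-- Pull-back of the right integrand `r` of `Ω` along the chart `κ(x,m) = (m²(1-x)/x, m)`, times the Jacobian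
`m²/x²`: the transported right integrand `r'` of `Ω'`. [folklore] -/
theorem kappa_pullback (a b : ℝ) {x m : ℝ} (hx : 0 < x) (hx1 : x < 1) (hm : 0 < m) (hm1 : m < 1)
    (hc : m * (1 - x) < x) :
    2 * ((4 * m * (m ^ 2 * (1 - x) / x)) ^ (a - 1) *
        (4 * (m ^ 2 * (1 - x) / x) * (m - m ^ 2 * (1 - x) / x) * (1 - m ^ 2)) ^ (2 * b - 1) *
        (64 * (m ^ 2 * (1 - x) / x)) ^ (1 / 2 - b) *
        (m * (m - m ^ 2 * (1 - x) / x) ^ 2 + m ^ 2 * (1 - x) / x * (1 + m) ^ 2) ^ (-a - 2 * b) *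
        (m ^ 2 * (1 - x) / x * (1 + m ^ 2 - 2 * m * (m ^ 2 * (1 - x) / x)))) * (m ^ 2 / x ^ 2) =
    1 / 2 * (x ^ (a + b - 3 / 2) * (4 * (1 - x)) ^ (a - b + 1 / 2) * m ^ (a - 1) *
      ((1 - x) * (x - m * (1 - x)) * (1 - m ^ 2)) ^ (2 * b - 1) *
      (m * (x - m * (1 - x)) ^ 2 + x * (1 - x) * (1 + m) ^ 2) ^ (-a - 2 * b) *
      (x + m ^ 2 * x - 2 * m ^ 3 * (1 - x))) := by
  have h1x : 0 < 1 - x := by linarith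
  have hu : 0 < x - m * (1 - x) := by linarith
  have h1m : 0 < 1 + m := by linarith
  have h1m' : 0 < 1 - m := by linarith
  have hD : 0 < m * (x - m * (1 - x)) ^ 2 + x * (1 - x) * (1 + m) ^ 2 := by positivity
  have hJ : 0 < x + m ^ 2 * x - 2 * m ^ 3 * (1 - x) := by
    have h1 : 2 * m ^ 3 * (1 - x) < 2 * m ^ 2 * x := by nlinarith [pow_pos hm 2]
    have h2 : 0 < x * (1 - m ^ 2) := mul_pos hx (by nlinarith)
    nlinarith
  have e1 : m - m ^ 2 * (1 - x) / x = m * (x - m * (1 - x)) / x := by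
    field_simp
  have e2 : 1 + m ^ 2 - 2 * m * (m ^ 2 * (1 - x) / x) = (x + m ^ 2 * x - 2 * m ^ 3 * (1 - x)) / x := by
    field_simp
  have e5 : m * (m * (x - m * (1 - x)) / x) ^ 2 + m ^ 2 * (1 - x) / x * (1 + m) ^ 2 =
      m ^ 2 * (m * (x - m * (1 - x)) ^ 2 + x * (1 - x) * (1 + m) ^ 2) / x ^ 2 := by
    field_simp
  have e3 : (1:ℝ) - m ^ 2 = (1 - m) * (1 + m) := by ring
  have e64 : (64:ℝ) = 2 ^ 6 := by norm_num
  have e4' : (4:ℝ) = 2 ^ 2 := by norm_num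
  rw [e1, e2, e5, e3, e64, e4']
  have hl : 0 < 2 * (((2:ℝ) ^ 2 * m * (m ^ 2 * (1 - x) / x)) ^ (a - 1) *
        ((2:ℝ) ^ 2 * (m ^ 2 * (1 - x) / x) * (m * (x - m * (1 - x)) / x) * ((1 - m) * (1 + m))) ^ (2 * b - 1) *
        ((2:ℝ) ^ 6 * (m ^ 2 * (1 - x) / x)) ^ (1 / 2 - b) *
        (m ^ 2 * (m * (x - m * (1 - x)) ^ 2 + x * (1 - x) * (1 + m) ^ 2) / x ^ 2) ^ (-a - 2 * b) *
        (m ^ 2 * (1 - x) / x * ((x + m ^ 2 * x - 2 * m ^ 3 * (1 - x)) / x))) * (m ^ 2 / x ^ 2) := by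
    positivity
  have hr : 0 < 1 / 2 * (x ^ (a + b - 3 / 2) * ((2:ℝ) ^ 2 * (1 - x)) ^ (a - b + 1 / 2) * m ^ (a - 1) *
      ((1 - x) * (x - m * (1 - x)) * ((1 - m) * (1 + m))) ^ (2 * b - 1) *
      (m * (x - m * (1 - x)) ^ 2 + x * (1 - x) * (1 + m) ^ 2) ^ (-a - 2 * b) *
      (x + m ^ 2 * x - 2 * m ^ 3 * (1 - x))) := by
    positivity
  rw [← Real.exp_log hl, ← Real.exp_log hr]
  congr 1
  simp (disch := positivity) only [Real.log_mul, Real.log_rpow, Real.log_div, Real.log_pow, Real.log_one]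
  ring

/-- Pull-back of the ghost integrand along the ghost chart `(t,m) ↦ (t, P)`, `P = 4mt/D̂`, times a factor
`4tw/D̂²` (`w = ±c`): the ghost term (`P(1+t)² - 4t = 4t(m-t)(1-m²)/D̂`). [folklore] -/
theorem pi_pullback (a b : ℝ) {t m : ℝ} (ht : 0 < t) (htm : t < m) (hm1 : m < 1) (w : ℝ) :
    1 * ((4 * m * t / (m * (m - t) ^ 2 + t * (1 + m) ^ 2)) ^ (a - 1) *
        (4 * m * t / (m * (m - t) ^ 2 + t * (1 + m) ^ 2) * (1 + t) ^ 2 - 4 * t) ^ (2 * b - 1) *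
        (64 * t) ^ (1 / 2 - b) * (2 * t) ^ (-1:ℝ)) *
      (4 * t * w / (m * (m - t) ^ 2 + t * (1 + m) ^ 2) ^ 2) =
    2 * ((4 * m * t) ^ (a - 1) * (4 * t * (m - t) * (1 - m ^ 2)) ^ (2 * b - 1) * (64 * t) ^ (1 / 2 - b) *
      (m * (m - t) ^ 2 + t * (1 + m) ^ 2) ^ (-a - 2 * b) * w) := by
  have hm : 0 < m := lt_trans ht htm
  have h1m : 0 < 1 + m := by linarith
  have h1m' : 0 < 1 - m := by linarith
  have hmt : 0 < m - t := by linarith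
  have hD : 0 < m * (m - t) ^ 2 + t * (1 + m) ^ 2 := by positivity
  have e1 : 4 * m * t / (m * (m - t) ^ 2 + t * (1 + m) ^ 2) * (1 + t) ^ 2 - 4 * t =
      4 * t * (m - t) * ((1 - m) * (1 + m)) / (m * (m - t) ^ 2 + t * (1 + m) ^ 2) := by
    field_simp
    ring
  have e3 : (1:ℝ) - m ^ 2 = (1 - m) * (1 + m) := by ring
  rw [e1, e3]
  suffices h : ((4 * m * t / (m * (m - t) ^ 2 + t * (1 + m) ^ 2)) ^ (a - 1) *
        (4 * t * (m - t) * ((1 - m) * (1 + m)) / (m * (m - t) ^ 2 + t * (1 + m) ^ 2)) ^ (2 * b - 1) *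
        (64 * t) ^ (1 / 2 - b) * (2 * t) ^ (-1:ℝ)) *
      (4 * t / (m * (m - t) ^ 2 + t * (1 + m) ^ 2) ^ 2) =
    2 * ((4 * m * t) ^ (a - 1) * (4 * t * (m - t) * ((1 - m) * (1 + m))) ^ (2 * b - 1) * (64 * t) ^ (1 / 2 - b) *
      (m * (m - t) ^ 2 + t * (1 + m) ^ 2) ^ (-a - 2 * b)) by
    linear_combination w * h
  have e64 : (64:ℝ) = 2 ^ 6 := by norm_num
  have e4' : (4:ℝ) = 2 ^ 2 := by norm_num
  rw [e64, e4']
  have hl : 0 < (((2:ℝ) ^ 2 * m * t / (m * (m - t) ^ 2 + t * (1 + m) ^ 2)) ^ (a - 1) *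
        ((2:ℝ) ^ 2 * t * (m - t) * ((1 - m) * (1 + m)) / (m * (m - t) ^ 2 + t * (1 + m) ^ 2)) ^ (2 * b - 1) *
        ((2:ℝ) ^ 6 * t) ^ (1 / 2 - b) * (2 * t) ^ (-1:ℝ)) *
      ((2:ℝ) ^ 2 * t / (m * (m - t) ^ 2 + t * (1 + m) ^ 2) ^ 2) := by
    positivity
  have hr : 0 < 2 * (((2:ℝ) ^ 2 * m * t) ^ (a - 1) * ((2:ℝ) ^ 2 * t * (m - t) * ((1 - m) * (1 + m))) ^ (2 * b - 1) *
      ((2:ℝ) ^ 6 * t) ^ (1 / 2 - b) * (m * (m - t) ^ 2 + t * (1 + m) ^ 2) ^ (-a - 2 * b)) := by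
    positivity
  rw [← Real.exp_log hl, ← Real.exp_log hr]
  congr 1
  simp (disch := positivity) only [Real.log_mul, Real.log_rpow, Real.log_div, Real.log_pow]
  ring

/-- The weight bookkeeping of the right box: `2x^{a+b-3/2}(4(1-x))^{a-b-½}y^{a-1}(1-y)^{2b-1}
= 4^{a-b}x^{a+b-3/2}(1-x)^{a-b-½}y^{a-1}(1-y)^{2b-1}`. [folklore] -/
theorem Rw_pin (a b : ℝ) {x y : ℝ} (hx : 0 < x) (hx1 : x < 1) (hy : 0 < y) (hy1 : y < 1) :
    2 * (x ^ (a + b - 3 / 2) * (4 * (1 - x)) ^ (a - b - 1 / 2) * y ^ (a - 1) * (1 - y) ^ (2 * b - 1)) =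
      (4:ℝ) ^ (a - b) * x ^ (a + b - 1 / 2 - 1) * (1 - x) ^ (a + 1 / 2 - b - 1) * y ^ (a - 1) *
        (1 - y) ^ (2 * b - 1) := by
  have h1x : 0 < 1 - x := by linarith
  have h1y : 0 < 1 - y := by linarith
  have e4' : (4:ℝ) = 2 ^ 2 := by norm_num
  rw [e4']
  have hl : 0 < 2 * (x ^ (a + b - 3 / 2) * ((2:ℝ) ^ 2 * (1 - x)) ^ (a - b - 1 / 2) * y ^ (a - 1) *
      (1 - y) ^ (2 * b - 1)) := by positivity
  have hr : 0 < ((2:ℝ) ^ 2) ^ (a - b) * x ^ (a + b - 1 / 2 - 1) * (1 - x) ^ (a + 1 / 2 - b - 1) * y ^ (a - 1) *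
      (1 - y) ^ (2 * b - 1) := by positivity
  rw [← Real.exp_log hl, ← Real.exp_log hr]
  congr 1
  simp (disch := positivity) only [Real.log_mul, Real.log_rpow, Real.log_pow]
  ring

end TwinDupStep

end Summit.KontsevichZagierPeriods.FermatIsogeny.BetaProductSectorStubs

end
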